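import Mathlib
import HarnessLib

/-!
# Crux `HypACumulant`, line `gnv` — Lipschitz bounds and bounded SECOND DIFFERENCES for free from
# holomorphy: the Schwarz-lemma estimates on a disc and on a bidisc

Route `route-HubbardSuperconductivity-ComplexGFFStiffness`, cruxes stmt-HubbardSuperconductivity-19154 /
-19155, shared research statement `OnePointLipschitz` (`N`-uniform `C^{1,1}` of the finite-volume free
energy on the `ι`-symmetric class), census entry (C3d) of `TWOPOINT-PLAN-cgffstiff2-g0.md` / `## Census`
of the `HypACumulant` line: the second-difference twin of the Lipschitz chain for the renormalisation maps
`S_k(H, K, q)`.  In the `(H, K)`-slots no chain is needed: at fixed real `q` every renormalisation map is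
an entire function of the COMPLEX data `(H, K)` (the tree's estimates are stated for complex relevant
Hamiltonians and complex activities in the norm balls, with no reality condition), and the norms are
suprema of absolute values of linear functionals; so Lipschitz constants AND parallelogram second
differences in `(H, K)` follow functional-by-functional from the ZEROTH-order bound `‖S_k‖ ≤ M` on a
complex ball, by the two estimates of this file (Schwarz lemma,
`Complex.dist_le_div_mul_dist_of_mapsTo_ball`):

* `norm_sub_le_of_bound_ball` — `f` holomorphic on the disc `|s| < R` with `‖f‖ ≤ M` there:
  `‖f s − f 0‖ ≤ (2M/R)·|s|`;
* `norm_secondDiff_le_of_bound_bidisc` — `g` separately holomorphic on the bidisc `|s|, |t| < R` with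
  `‖g‖ ≤ M` there: `‖g s t − g s 0 − g 0 t + g 0 0‖ ≤ (4M/R²)·|s|·|t|`;
* `norm_lineDiff_le_of_bound`, `norm_parallelogram_le_of_bound` — the same along complex lines
  `a + s•u (+ t•v)` of a map `Φ : V → F` on a complex vector space that is holomorphic along lines and
  bounded by `M` on the relevant line/plane segments: `‖Φ(a+u) − Φ(a)‖ ≤ 2M/R` and
  `‖Φ(a+u+v) − Φ(a+u) − Φ(a+v) + Φ(a)‖ ≤ 4M/R²` whenever the discs of radius `R > 1` fit.

Pure complex analysis (values in any complex Banach space `F`); nothing here is specific to the model.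
All proved, no `sorry`.

## References
* S. Adams, S. Buchholz, R. Kotecký, S. Müller, arXiv:1910.13564, Ch. 10–11 (smoothness of the
  renormalisation maps in `(H, K)`, there by explicit multilinear estimates) [AdamsBuchholzKoteckyMuller2019].
-/

noncomputable section

-- `Summit.<Summit>.<Problem>`: single-conjunct summit, the duplicate component is mandated (D-0017).
set_option linter.dupNamespace false

namespace Summit.HubbardSuperconductivity.HubbardSuperconductivity.Theorems.ComplexGFF

open Metric Set

variable {F : Type*} [NormedAddCommGroup F] [NormedSpace ℂ F]

/-- **Lipschitz at the centre from a sup bound (Schwarz).** If `f` is holomorphic on the disc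
`|s| < R` and `‖f s‖ ≤ M` there, then `‖f s − f 0‖ ≤ (2M/R)·‖s‖` for `|s| < R`. -/
theorem norm_sub_le_of_bound_ball {f : ℂ → F} {R M : ℝ} (hd : DifferentiableOn ℂ f (ball (0 : ℂ) R))
    (hM : ∀ s ∈ ball (0 : ℂ) R, ‖f s‖ ≤ M) {s : ℂ} (hs : s ∈ ball (0 : ℂ) R) :
    ‖f s - f 0‖ ≤ 2 * M / R * ‖s‖ := by
  have hR : 0 < R := lt_of_le_of_lt (norm_nonneg s) (mem_ball_zero_iff.mp hs)
  have h0 : (0 : ℂ) ∈ ball (0 : ℂ) R := mem_ball_self hR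
  have hmaps : MapsTo f (ball (0 : ℂ) R) (closedBall (f 0) (2 * M)) := by
    intro z hz
    rw [mem_closedBall, dist_eq_norm]
    calc ‖f z - f 0‖ ≤ ‖f z‖ + ‖f 0‖ := norm_sub_le _ _
      _ ≤ M + M := add_le_add (hM z hz) (hM 0 h0)
      _ = 2 * M := by ring
  have h := Complex.dist_le_div_mul_dist_of_mapsTo_ball hd hmaps hs
  rwa [dist_eq_norm, dist_zero_right] at h

/-- **Bounded second differences from a sup bound on a bidisc.** If `g s t` is holomorphic in `s` for
each `t` and in `t` for each `s` on the bidisc `|s|, |t| < R`, and `‖g s t‖ ≤ M` there, then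
`‖g s t − g s 0 − g 0 t + g 0 0‖ ≤ (4M/R²)·‖s‖·‖t‖`. -/
theorem norm_secondDiff_le_of_bound_bidisc {g : ℂ → ℂ → F} {R M : ℝ}
    (hds : ∀ t ∈ ball (0 : ℂ) R, DifferentiableOn ℂ (fun s => g s t) (ball (0 : ℂ) R))
    (hdt : ∀ s ∈ ball (0 : ℂ) R, DifferentiableOn ℂ (g s) (ball (0 : ℂ) R))
    (hM : ∀ s ∈ ball (0 : ℂ) R, ∀ t ∈ ball (0 : ℂ) R, ‖g s t‖ ≤ M)
    {s t : ℂ} (hs : s ∈ ball (0 : ℂ) R) (ht : t ∈ ball (0 : ℂ) R) :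
    ‖g s t - g s 0 - g 0 t + g 0 0‖ ≤ 4 * M / R ^ 2 * ‖s‖ * ‖t‖ := by
  have hR : 0 < R := lt_of_le_of_lt (norm_nonneg s) (mem_ball_zero_iff.mp hs)
  have h0 : (0 : ℂ) ∈ ball (0 : ℂ) R := mem_ball_self hR
  -- `h(s) = g s t − g s 0` is holomorphic in `s` and bounded by `(2M/R)‖t‖`
  set h : ℂ → F := fun s' => g s' t - g s' 0 with hh
  have hdh : DifferentiableOn ℂ h (ball (0 : ℂ) R) := (hds t ht).sub (hds 0 h0)
  have hbh : ∀ s' ∈ ball (0 : ℂ) R, ‖h s'‖ ≤ 2 * M / R * ‖t‖ := fun s' hs' =>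
    norm_sub_le_of_bound_ball (hdt s' hs') (hM s' hs') ht
  have hmain := norm_sub_le_of_bound_ball hdh hbh hs
  have e : h s - h 0 = g s t - g s 0 - g 0 t + g 0 0 := by simp only [hh]; abel
  rw [e] at hmain
  refine le_trans hmain (le_of_eq ?_)
  field_simp
  ring

/-! ### Along complex lines of a map on a complex vector space -/

variable {V : Type*} [AddCommGroup V] [Module ℂ V]

/-- **First differences along a complex line.** If `s ↦ Φ(a + s•u)` is holomorphic on `|s| < R` with
values of norm `≤ M`, and `1 < R`, then `‖Φ(a + u) − Φ(a)‖ ≤ 2M/R`. -/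
theorem norm_lineDiff_le_of_bound (Φ : V → F) (a u : V) {R M : ℝ} (hR : 1 < R)
    (hd : DifferentiableOn ℂ (fun s : ℂ => Φ (a + s • u)) (ball (0 : ℂ) R))
    (hM : ∀ s ∈ ball (0 : ℂ) R, ‖Φ (a + s • u)‖ ≤ M) :
    ‖Φ (a + u) - Φ a‖ ≤ 2 * M / R := by
  have h1 : (1 : ℂ) ∈ ball (0 : ℂ) R := by simpa using hR
  have h := norm_sub_le_of_bound_ball hd hM h1
  simpa using h

/-- **Parallelogram second differences along complex lines.** If `(s,t) ↦ Φ(a + s•u + t•v)` is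
separately holomorphic on the bidisc `|s|, |t| < R` with values of norm `≤ M`, and `1 < R`, then
`‖Φ(a+u+v) − Φ(a+u) − Φ(a+v) + Φ(a)‖ ≤ 4M/R²`.  (Scaling `u ↦ λu`, `v ↦ μv` recovers the bilinear
form `≤ 4M|λ||μ|/R²` of the estimate.) -/
theorem norm_parallelogram_le_of_bound (Φ : V → F) (a u v : V) {R M : ℝ} (hR : 1 < R)
    (hds : ∀ t ∈ ball (0 : ℂ) R, DifferentiableOn ℂ (fun s : ℂ => Φ (a + s • u + t • v)) (ball (0 : ℂ) R))
    (hdt : ∀ s ∈ ball (0 : ℂ) R, DifferentiableOn ℂ (fun t : ℂ => Φ (a + s • u + t • v)) (ball (0 : ℂ) R))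
    (hM : ∀ s ∈ ball (0 : ℂ) R, ∀ t ∈ ball (0 : ℂ) R, ‖Φ (a + s • u + t • v)‖ ≤ M) :
    ‖Φ (a + u + v) - Φ (a + u) - Φ (a + v) + Φ a‖ ≤ 4 * M / R ^ 2 := by
  have h1 : (1 : ℂ) ∈ ball (0 : ℂ) R := by simpa using hR
  have h := norm_secondDiff_le_of_bound_bidisc (g := fun s t : ℂ => Φ (a + s • u + t • v)) hds hdt hM h1 h1
  simpa using h

/-- **Scaled form**: under the hypotheses of `norm_parallelogram_le_of_bound` with the bidisc of radius
`R`, for all complex `λ, μ` with `|λ|, |μ| < R`: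
`‖Φ(a+λu+μv) − Φ(a+λu) − Φ(a+μv) + Φ(a)‖ ≤ (4M/R²)|λ||μ|`. -/
theorem norm_parallelogram_smul_le_of_bound (Φ : V → F) (a u v : V) {R M : ℝ}
    (hds : ∀ t ∈ ball (0 : ℂ) R, DifferentiableOn ℂ (fun s : ℂ => Φ (a + s • u + t • v)) (ball (0 : ℂ) R))
    (hdt : ∀ s ∈ ball (0 : ℂ) R, DifferentiableOn ℂ (fun t : ℂ => Φ (a + s • u + t • v)) (ball (0 : ℂ) R))
    (hM : ∀ s ∈ ball (0 : ℂ) R, ∀ t ∈ ball (0 : ℂ) R, ‖Φ (a + s • u + t • v)‖ ≤ M)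
    {c d : ℂ} (hc : c ∈ ball (0 : ℂ) R) (hd' : d ∈ ball (0 : ℂ) R) :
    ‖Φ (a + c • u + d • v) - Φ (a + c • u) - Φ (a + d • v) + Φ a‖ ≤ 4 * M / R ^ 2 * ‖c‖ * ‖d‖ := by
  have h := norm_secondDiff_le_of_bound_bidisc (g := fun s t : ℂ => Φ (a + s • u + t • v)) hds hdt hM hc hd'
  simpa using h

end Summit.HubbardSuperconductivity.HubbardSuperconductivity.Theorems.ComplexGFF

end
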